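import Summits.HodgeConjecture.HodgeConjecture.Theses.LinearSystemTorelli
import Literature.AlgebraicGeometry.HodgeTheory.HodgeTypeExteriorProduct
import Literature.AlgebraicGeometry.HodgeTheory.HodgeTypePullbackVanishing
import Literature.AlgebraicGeometry.HodgeTheory.HodgeFiltrationModelsReductionProofs
import Literature.AlgebraicGeometry.HodgeTheory.ComplexConjugationHolds
import Literature.AlgebraicGeometry.HodgeTheory.ComplexGysinHodgeType
import Literature.Barriers.HodgeConjecture.GeneralizedHodgeTrivialReasonsParity
import Literature.AlgebraicGeometry.HodgeTheory.GysinHodgeClassLiftProofs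
import Literature.AlgebraicGeometry.HodgeTheory.GysinKernelProofs
import Literature.AlgebraicGeometry.HodgeTheory.RationalClassesRingChange
import Literature.AlgebraicGeometry.HodgeTheory.SupportedClassesRationalProofs
import Literature.AlgebraicGeometry.HodgeTheory.VanishingCohomologyNontrivialProofs
import Literature.AlgebraicGeometry.Motives.ComplexPointsOrientation
import Literature.AlgebraicTopology.SingularHomology.GysinTransposition
import Summits.HodgeConjecture.HodgeConjecture.Theorems.LinearSystemTorelliTranscendentalOrSupportedStubInvisibleOfPerpSwept
import Summits.HodgeConjecture.HodgeConjecture.Theorems.LinearSystemTorelliTranscendentalOrSupportedStubPerpRatSpanned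

/-!
# Crux `TranscendentalOrSupported` (stmt-HodgeConjecture-10853), line `Sketch` — REMARKS (lead), II:
# the NO-GO `T(X) ⊆ LocTriv` — transcendental classes are invisible

Companion of `Lines/Sketch.lean`. The core stub `stub_invisibleTranscendental` bets that every class
invisible on all smooth projective varieties of dimension `< 2p` over the `2p`-fold `X` lies in the
transcendental part `T(X) ⊗ ℂ` (the intersection of the rationally spanned sub-Hodge structures
containing `H^{2p,0}`). Here the CONVERSE inclusion (the route's no-go "`LocTriv ⊇ T(X)`"): the
invisible classes `K ⊆ H²ᵖ(X(ℂ); ℂ)` form a sub-Hodge structure (pull-backs preserve Hodge types,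
`preservesHodgeType_of_isSmoothProjective`, and the pieces are independent) containing every class of
type `(2p, 0)` (top forms die on lower-dimensional varieties, `IsOfHodgeType.map_eq_zero_of_lt_left`);
and `K` is spanned by its rational classes: it is the right-orthogonal, for the cup product pairing, of
the span `S` of the Gysin images from lower-dimensional varieties (transposition `cupPairing_gysinMap`
and the landed `stub_invisibleOfPerpSwept`), `S` is spanned by RATIONAL classes (`complexGysin μ` of a
rational class is a rational class up to the orientation scalar, `complexGysin_ringChange_eq_smul_gysinMap`),
hence by finitely many of them, and the right-orthogonal of finitely many rational classes is rationally
spanned (the landed `stub_perpRatSpanned`). Hence every transcendental class is invisible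
(`isInvisible_of_isTranscendental`), unconditionally.
-/

noncomputable section

set_option linter.dupNamespace false

open CategoryTheory
open Literature.AlgebraicGeometry.Motives Literature.AlgebraicGeometry.HodgeTheory
open Literature.AlgebraicTopology.SingularHomology
open Summit.HodgeConjecture.HodgeConjecture.Theorems

namespace Summit.HodgeConjecture.HodgeConjecture.Cruxes.TranscendentalOrSupported.CurveSweep

variable {p : ℕ} {X : SchemeOver ℂ}

/-- The INVISIBLE classes of the `2p`-fold `X` as a subspace of `H²ᵖ(X(ℂ); ℂ)`: the joint kernel of the
pull-backs `g^*` along all `g : Y ⟶ X`, `Y` smooth projective of dimension `< 2p`. -/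
def invisibleClasses (p : ℕ) (X : SchemeOver ℂ) : Submodule ℂ (complexBetti X (2 * p)) :=
  ⨅ (m : ℕ) (Y : SchemeOver ℂ) (_ : IsSmoothProjective m Y) (_ : m < 2 * p) (g : Y ⟶ X),
    LinearMap.ker (complexBetti.map g (2 * p)).hom

/-- Membership in `invisibleClasses` is invisibility. -/
theorem mem_invisibleClasses_iff (c : complexBetti X (2 * p)) :
    c ∈ invisibleClasses p X ↔
      ∀ (m : ℕ) (Y : SchemeOver ℂ), IsSmoothProjective m Y → m < 2 * p → ∀ g : Y ⟶ X,
        complexBetti.map g (2 * p) c = 0 := by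
  simp only [invisibleClasses, Submodule.mem_iInf, LinearMap.mem_ker]

/-- **Classes of type `(2p, 0)` are invisible**: the pull-back of a `(2p,0)`-class to a smooth
projective `Y` of dimension `m < 2p` vanishes (there are no `(2p,0)`-forms on `Y^an`;
`IsOfHodgeType.map_eq_zero_of_lt_left`, Voisin II (10.9)). -/
theorem mem_invisibleClasses_of_isOfHodgeType_top (hX : IsSmoothProjective (2 * p) X)
    {c : complexBetti X (2 * p)} (hc : IsOfHodgeType (2 * p) X (2 * p) (2 * p) 0 c) :
    c ∈ invisibleClasses p X := by
  rw [mem_invisibleClasses_iff]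
  intro m Y hY hm g
  exact hc.map_eq_zero_of_lt_left hY hX (nonempty_hodgeModel_holds hY).some g hm

/-- **A sum of classes of distinct pure Hodge types vanishes only if every summand does** (independence
of the pieces `H^{a,b}`, `a + b = k`, of a Hodge model; `HodgeModel.iSupIndep_hodgePQ`). -/
theorem eq_zero_of_sum_eq_zero_of_hodgeType {n : ℕ} {Y : SchemeOver ℂ} (B : HodgeModel n Y) (k : ℕ)
    (z : ℕ × ℕ → complexBetti Y k)
    (hz : ∀ i ∈ Finset.HasAntidiagonal.antidiagonal k, B.pullback k (z i) ∈ B.hodgePQ k i.1 i.2)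
    (hsum : ∑ i ∈ Finset.HasAntidiagonal.antidiagonal k, z i = 0) :
    ∀ i ∈ Finset.HasAntidiagonal.antidiagonal k, z i = 0 := by
  classical
  have hind := B.iSupIndep_hodgePQ k
  intro i hi
  -- work upstairs with `w i = B^* z i`
  have key : B.pullback k (z i) = 0 := by
    have hsum' : ∑ j ∈ Finset.HasAntidiagonal.antidiagonal k, B.pullback k (z j) = 0 := by
      rw [← map_sum]
      change (B.pullback k).hom (∑ j ∈ Finset.HasAntidiagonal.antidiagonal k, z j) = 0
      rw [hsum, map_zero]
    -- `B^* z i = - Σ_{j ≠ i} B^* z j ∈ H^{i} ⊓ ⨆_{j ≠ i} H^{j} = 0`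
    have hmem : B.pullback k (z i) ∈
        ⨆ j ∈ {j : ↥(Finset.HasAntidiagonal.antidiagonal k) | j ≠ ⟨i, hi⟩}, B.hodgePQ k j.1.1 j.1.2 := by
      have heq : B.pullback k (z i) = -∑ j ∈ (Finset.HasAntidiagonal.antidiagonal k).erase i, B.pullback k (z j) := by
        rw [← Finset.add_sum_erase _ _ hi] at hsum'
        exact eq_neg_of_add_eq_zero_left hsum'
      rw [heq]
      refine Submodule.neg_mem _ (Submodule.sum_mem _ fun j hj ↦ ?_)
      obtain ⟨hji, hjk⟩ := Finset.mem_erase.1 hj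
      exact Submodule.mem_iSup_of_mem ⟨j, hjk⟩
        (Submodule.mem_iSup_of_mem (show (⟨j, hjk⟩ : ↥(Finset.HasAntidiagonal.antidiagonal k)) ∈
            {j : ↥(Finset.HasAntidiagonal.antidiagonal k) | j ≠ ⟨i, hi⟩} from
          fun h ↦ hji (congrArg Subtype.val h)) (hz j hjk))
    exact (Submodule.disjoint_def.1
      (hind.disjoint_biSup (x := ⟨i, hi⟩) (y := {j | j ≠ ⟨i, hi⟩}) (fun h ↦ h rfl))) _ (hz i hi) hmem
  exact B.pullback_injective k (by rw [key, map_zero])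

/-- **The invisible classes form a sub-Hodge structure** (read in any Hodge model `A` of `X`): the
pure-type components of an invisible class are invisible, because `g^*` preserves Hodge types
(`preservesHodgeType_of_isSmoothProjective`) and a sum of classes of distinct pure types on `Y`
vanishes only termwise (`eq_zero_of_sum_eq_zero_of_hodgeType`). -/
theorem invisibleClasses_isSubHodge (hX : IsSmoothProjective (2 * p) X) (A : HodgeModel (2 * p) X) :
    (invisibleClasses p X).map (A.pullback (2 * p)).hom =
      ⨆ (p' : ℕ) (q' : ℕ) (_ : p' + q' = 2 * p),
        (invisibleClasses p X).map (A.pullback (2 * p)).hom ⊓ A.hodgePQ (2 * p) p' q' := by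
  classical
  refine le_antisymm ?_ (iSup_le fun _ ↦ iSup_le fun _ ↦ iSup_le fun _ ↦ inf_le_left)
  rintro _ ⟨c, hc, rfl⟩
  obtain ⟨z, hzc, hz⟩ := A.exists_sum_eq_of_hodgeDecomposition (2 * p) c
  -- each component is invisible
  have hzK : ∀ i ∈ Finset.HasAntidiagonal.antidiagonal (2 * p), z i ∈ invisibleClasses p X := by
    intro i hi
    rw [mem_invisibleClasses_iff]
    intro m Y hY hm g
    obtain ⟨B⟩ := nonempty_hodgeModel_holds hY
    -- the pulled-back components have pure types on `Y` and sum to `g^* c = 0`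
    have htype : ∀ j ∈ Finset.HasAntidiagonal.antidiagonal (2 * p),
        B.pullback (2 * p) (complexBetti.map g (2 * p) (z j)) ∈ B.hodgePQ (2 * p) j.1 j.2 := by
      intro j hj
      have h1 : IsOfHodgeType m Y (2 * p) j.1 j.2 (complexBetti.map g (2 * p) (z j)) :=
        preservesHodgeType_of_isSmoothProjective hY hX g ⟨A, hz j hj⟩
      exact (hodgePQ_independent_of_hodgeModel_holds.isOfHodgeType_iff hY B).1 h1
    have hsum : ∑ j ∈ Finset.HasAntidiagonal.antidiagonal (2 * p), complexBetti.map g (2 * p) (z j) = 0 := by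
      rw [← map_sum]
      change (complexBetti.map g (2 * p)).hom (∑ j ∈ Finset.HasAntidiagonal.antidiagonal (2 * p), z j) = 0
      rw [hzc]
      exact (mem_invisibleClasses_iff c).1 hc m Y hY hm g
    exact eq_zero_of_sum_eq_zero_of_hodgeType B (2 * p) (fun j ↦ complexBetti.map g (2 * p) (z j))
      htype hsum i hi
  -- reassemble
  have : (A.pullback (2 * p)).hom c = ∑ i ∈ Finset.HasAntidiagonal.antidiagonal (2 * p), A.pullback (2 * p) (z i) := by
    rw [← hzc, map_sum]
  rw [this]
  refine Submodule.sum_mem _ fun i hi ↦ ?_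
  exact Submodule.mem_iSup_of_mem i.1 (Submodule.mem_iSup_of_mem i.2
    (Submodule.mem_iSup_of_mem (Finset.HasAntidiagonal.mem_antidiagonal.1 hi)
      ⟨Submodule.mem_map_of_mem (hzK i hi), hz i hi⟩))

/-- **The no-go, granted the rational structure of the invisible classes**: if the invisible classes
are spanned by their rational classes, then every TRANSCENDENTAL class (one lying in every rationally
spanned sub-Hodge structure containing the `(2p,0)`-classes) is invisible — `T(X) ⊆ LocTriv`. -/
theorem isInvisible_of_isTranscendental_of_ratSpanned (hX : IsSmoothProjective (2 * p) X)
    (A : HodgeModel (2 * p) X)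
    (hrat : Submodule.span ℂ {x : complexBetti X (2 * p) | x ∈ invisibleClasses p X ∧ IsRationalClass x} =
      invisibleClasses p X)
    {c : complexBetti X (2 * p)}
    (ht : ∀ V : Submodule ℂ (complexBetti X (2 * p)),
      Submodule.span ℂ {x : complexBetti X (2 * p) | x ∈ V ∧ IsRationalClass x} = V →
      V.map (A.pullback (2 * p)).hom =
        ⨆ (p' : ℕ) (q' : ℕ) (_ : p' + q' = 2 * p), V.map (A.pullback (2 * p)).hom ⊓ A.hodgePQ (2 * p) p' q' →
      (∀ x : complexBetti X (2 * p), A.pullback (2 * p) x ∈ A.hodgePQ (2 * p) (2 * p) 0 → x ∈ V) →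
      c ∈ V) :
    ∀ (m : ℕ) (Y : SchemeOver ℂ), IsSmoothProjective m Y → m < 2 * p → ∀ g : Y ⟶ X,
      complexBetti.map g (2 * p) c = 0 :=
  (mem_invisibleClasses_iff c).1
    (ht _ hrat (invisibleClasses_isSubHodge hX A)
      fun _ hx ↦ mem_invisibleClasses_of_isOfHodgeType_top hX ⟨A, hx⟩)

/-! ### The invisible classes are spanned by rational classes -/

/-- **A rationally spanned subspace of `Hᵏ(X(ℂ); ℂ)` is the span of finitely many of its rational
classes** (`Hᵏ(X(ℂ); ℂ)` is finite-dimensional, `finite_complexBetti`). -/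
theorem exists_fin_isRationalClass_span_eq {n : ℕ} (hX : IsSmoothProjective n X) (k : ℕ)
    (V : Submodule ℂ (complexBetti X k))
    (hV : Submodule.span ℂ {x : complexBetti X k | x ∈ V ∧ IsRationalClass x} = V) :
    ∃ (r : ℕ) (v : Fin r → complexBetti X k), (∀ i, IsRationalClass (v i)) ∧
      Submodule.span ℂ (Set.range v) = V := by
  haveI : Module.Finite ℂ (complexBetti X k) := finite_complexBetti hX k
  obtain ⟨t, ht, hspan, hli⟩ :=
    exists_linearIndependent ℂ {x : complexBetti X k | x ∈ V ∧ IsRationalClass x}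
  have htfin : t.Finite := hli.set_finite_of_isNoetherian
  haveI : Fintype t := htfin.fintype
  refine ⟨Fintype.card t, (↑) ∘ (Fintype.equivFin t).symm,
    fun i ↦ (ht ((Fintype.equivFin t).symm i).2).2, ?_⟩
  rw [EquivLike.range_comp, Subtype.range_coe, hspan, hV]

/-- **Gysin images are cup-orthogonal to invisible classes** (transposition `cupPairing_gysinMap`;
in degrees `a > 2 dim Y` the Gysin morphism is `0`). -/
theorem cupPairing_complexGysin_eq_zero_of_map_eq_zero' (μ : OrientationFamily)
    (hX : IsSmoothProjective (2 * p) X) {m : ℕ} {Y : SchemeOver ℂ} (hY : IsSmoothProjective m Y)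
    (g : Y ⟶ X) {a : ℕ} (hab : a + 2 * (2 * p) = 2 * p + 2 * m) (y : complexBetti Y a)
    {c : complexBetti X (2 * p)} (hc : complexBetti.map g (2 * p) c = 0) :
    cupPairing (μ hX) (two_mul (2 * p)).symm (complexGysin μ hY hX g hab y) c = 0 := by
  by_cases ha : a ≤ 2 * m
  · rw [complexGysin_eq_gysinMap hY hX g hab (q := 2 * p) (by omega) (two_mul (2 * p)).symm,
      cupPairing_gysinMap (μ.hasPoincareDuality hX)]
    change cupPairing (μ hY) _ y (complexBetti.map g (2 * p) c) = 0
    rw [hc, map_zero]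
  · rw [complexGysin_of_lt hY hX g hab (by omega), LinearMap.zero_apply, map_zero,
      LinearMap.zero_apply]

/-- **A Gysin image from a lower-dimensional variety lies in the span of the RATIONAL classes of the
range of the Gysin morphism**: `Hᵃ(Y(ℂ); ℂ)` is spanned by rational classes
(`span_isRationalClass_eq_top_of_isSmoothProjective_holds`), and `g_*` of a rational class `y ⊗ 1` is
`u • (g_! y ⊗ 1)` for the rational Gysin map `g_!` of some `ℚ`-orientations and a unit `u`
(`complexGysin_ringChange_eq_smul_gysinMap`), a multiple of a rational class in the range. -/
theorem complexGysin_mem_span_rational (μ : OrientationFamily) (hX : IsSmoothProjective (2 * p) X)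
    {m : ℕ} {Y : SchemeOver ℂ} (hY : IsSmoothProjective m Y) (g : Y ⟶ X) {a : ℕ}
    (hab : a + 2 * (2 * p) = 2 * p + 2 * m) (y : complexBetti Y a) :
    complexGysin μ hY hX g hab y ∈ Submodule.span ℂ {ρ : complexBetti X (2 * p) |
      ρ ∈ LinearMap.range (complexGysin μ hY hX g hab) ∧ IsRationalClass ρ} := by
  by_cases ha : a ≤ 2 * m
  · obtain ⟨νY⟩ := ComplexPoints.isOrientableOver ℚ hY
    obtain ⟨νX, hνX⟩ := exists_ratOrientation_hasPoincareDuality hX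
    obtain ⟨u, hu0, hu⟩ := complexGysin_ringChange_eq_smul_gysinMap (μ := μ) μ.hasPoincareDuality hY hX g
      (show a + 2 * p = 2 * m by omega) (two_mul (2 * p)).symm νY νX hνX
    -- reduce to rational `y`
    have hy : y ∈ Submodule.span ℂ {c : complexBetti Y a | IsRationalClass c} := by
      rw [span_isRationalClass_eq_top_of_isSmoothProjective_holds m Y hY a]; exact Submodule.mem_top
    induction hy using Submodule.span_induction with
    | mem y0 hy0 =>
      obtain ⟨yq, rfl⟩ := (isRationalClass_iff_mem_range_ofRatClass y0).1 hy0
      rw [ofRatClass_eq_ringChange]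
      have e := hu yq
      -- `g_* (y ⊗ 1) = u • ρ` with `ρ` rational and `ρ = u⁻¹ • g_* (y ⊗ 1)` in the range
      set ρ := singularCohomology.ringChange (algebraMap ℚ ℂ) (ComplexPoints X) (2 * p)
        (gysinMap νY νX (AlgPoints.mapContinuous (L := ℂ) g) (show a + 2 * p = 2 * m by omega)
          (two_mul (2 * p)).symm yq) with hρ
      have hρmem : ρ ∈ LinearMap.range (complexGysin μ hY hX g hab) := by
        refine ⟨u⁻¹ • singularCohomology.ringChange (algebraMap ℚ ℂ) (ComplexPoints Y) a yq, ?_⟩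
        rw [map_smul, e, smul_smul, inv_mul_cancel₀ hu0, one_smul]
      rw [e]
      exact Submodule.smul_mem _ u (Submodule.subset_span ⟨hρmem, by rw [hρ]; exact isRationalClass_ringChange _⟩)
    | zero => rw [map_zero]; exact Submodule.zero_mem _
    | add x y _ _ hx hy => rw [map_add]; exact Submodule.add_mem _ hx hy
    | smul t x _ hx => rw [map_smul]; exact Submodule.smul_mem _ t hx
  · rw [complexGysin_of_lt hY hX g hab (by omega), LinearMap.zero_apply]
    exact Submodule.zero_mem _

/-- **The invisible classes are spanned by their rational classes.** With `S` the span of the Gysin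
images from smooth projective varieties of dimension `< 2p`: `S` is spanned by rational classes
(`complexGysin_mem_span_rational`), hence by finitely many of them, `ρ₁, …, ρ_N`
(`exists_fin_isRationalClass_span_eq`); the invisible classes are exactly the right-orthogonal
`⨅ᵢ ker ⟨ρ i ⌣ –, [X]⟩` of `S` (transposition, `cupPairing_complexGysin_eq_zero_of_map_eq_zero'`, and
the landed `stub_invisibleOfPerpSwept`), which is rationally spanned by the landed `stub_perpRatSpanned`. -/
theorem invisibleClasses_ratSpanned (hX : IsSmoothProjective (2 * p) X) :
    Submodule.span ℂ {x : complexBetti X (2 * p) | x ∈ invisibleClasses p X ∧ IsRationalClass x} =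
      invisibleClasses p X := by
  classical
  let μ : OrientationFamily := fun _ _ h ↦ Classical.choice (ComplexPoints.isOrientableOver ℂ h)
  -- the swept classes
  let S : Submodule ℂ (complexBetti X (2 * p)) :=
    ⨆ (m : ℕ) (Y : SchemeOver ℂ) (hY : IsSmoothProjective m Y) (_ : m < 2 * p) (g : Y ⟶ X) (a : ℕ)
      (hab : a + 2 * (2 * p) = 2 * p + 2 * m), LinearMap.range (complexGysin μ hY hX g hab)
  -- `S` is spanned by its rational classes
  have hSrat : Submodule.span ℂ {x : complexBetti X (2 * p) | x ∈ S ∧ IsRationalClass x} = S := by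
    refine le_antisymm (Submodule.span_le.2 fun x hx ↦ hx.1) ?_
    refine iSup_le fun m ↦ iSup_le fun Y ↦ iSup_le fun hY ↦ iSup_le fun hm ↦ iSup_le fun g ↦
      iSup_le fun a ↦ iSup_le fun hab ↦ ?_
    have hle : LinearMap.range (complexGysin μ hY hX g hab) ≤ S :=
      le_iSup_of_le m <| le_iSup_of_le Y <| le_iSup_of_le hY <| le_iSup_of_le hm <|
        le_iSup_of_le g <| le_iSup_of_le a <| le_iSup_of_le hab le_rfl
    rintro _ ⟨y, rfl⟩
    refine Submodule.span_mono ?_ (complexGysin_mem_span_rational μ hX hY g hab y)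
    rintro ρ ⟨hρ, hρrat⟩
    exact ⟨hle hρ, hρrat⟩
  -- a finite rational spanning family of `S`
  obtain ⟨N, ρ, hρ, hρS⟩ := exists_fin_isRationalClass_span_eq hX (2 * p) S hSrat
  -- the invisible classes are the right-orthogonal of `S = span ρ`
  have hK : invisibleClasses p X = ⨅ i, LinearMap.ker (cupPairing (μ hX) (two_mul (2 * p)).symm (ρ i)) := by
    refine le_antisymm ?_ ?_
    · intro c hc
      rw [mem_invisibleClasses_iff] at hc
      -- `S ≤ ker ⟨– ⌣ c, [X]⟩`
      have hS : S ≤ LinearMap.ker ((cupPairing (μ hX) (two_mul (2 * p)).symm).flip c) := by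
        refine iSup_le fun m ↦ iSup_le fun Y ↦ iSup_le fun hY ↦ iSup_le fun hm ↦ iSup_le fun g ↦
          iSup_le fun a ↦ iSup_le fun hab ↦ ?_
        rintro _ ⟨y, rfl⟩
        rw [LinearMap.mem_ker, LinearMap.flip_apply]
        exact cupPairing_complexGysin_eq_zero_of_map_eq_zero' μ hX hY g hab y (hc m Y hY hm g)
      refine (Submodule.mem_iInf _).2 fun i ↦ LinearMap.mem_ker.2 ?_
      have hi : ρ i ∈ S := hρS ▸ Submodule.subset_span ⟨i, rfl⟩
      have := hS hi
      rwa [LinearMap.mem_ker, LinearMap.flip_apply] at this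
    · intro c hc
      rw [mem_invisibleClasses_iff]
      refine stub_invisibleOfPerpSwept μ hX c fun m Y hY hm g a hab y ↦ ?_
      have hgen : complexGysin μ hY hX g hab y ∈ Submodule.span ℂ (Set.range ρ) := by
        rw [hρS]
        exact Submodule.mem_iSup_of_mem m <| Submodule.mem_iSup_of_mem Y <|
          Submodule.mem_iSup_of_mem hY <| Submodule.mem_iSup_of_mem hm <|
          Submodule.mem_iSup_of_mem g <| Submodule.mem_iSup_of_mem a <|
          Submodule.mem_iSup_of_mem hab <| LinearMap.mem_range_self _ y
      -- linearity in the left slot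
      have hle : Submodule.span ℂ (Set.range ρ) ≤
          LinearMap.ker ((cupPairing (μ hX) (two_mul (2 * p)).symm).flip c) := by
        rw [Submodule.span_le]
        rintro _ ⟨i, rfl⟩
        rw [SetLike.mem_coe, LinearMap.mem_ker, LinearMap.flip_apply]
        exact LinearMap.mem_ker.1 ((Submodule.mem_iInf _).1 hc i)
      have := hle hgen
      rwa [LinearMap.mem_ker, LinearMap.flip_apply] at this
  rw [hK]
  exact stub_perpRatSpanned μ hX N ρ hρ

/-- **THE NO-GO `T(X) ⊆ LocTriv`, unconditionally**: every transcendental class of `H²ᵖ(X(ℂ); ℂ)`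
(one lying in every rationally spanned sub-Hodge structure containing the `(2p,0)`-classes) is
invisible on every smooth projective variety of dimension `< 2p` over `X`. -/
theorem isInvisible_of_isTranscendental (hX : IsSmoothProjective (2 * p) X) (A : HodgeModel (2 * p) X)
    {c : complexBetti X (2 * p)}
    (ht : ∀ V : Submodule ℂ (complexBetti X (2 * p)),
      Submodule.span ℂ {x : complexBetti X (2 * p) | x ∈ V ∧ IsRationalClass x} = V →
      V.map (A.pullback (2 * p)).hom =
        ⨆ (p' : ℕ) (q' : ℕ) (_ : p' + q' = 2 * p), V.map (A.pullback (2 * p)).hom ⊓ A.hodgePQ (2 * p) p' q' →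
      (∀ x : complexBetti X (2 * p), A.pullback (2 * p) x ∈ A.hodgePQ (2 * p) (2 * p) 0 → x ∈ V) →
      c ∈ V) :
    ∀ (m : ℕ) (Y : SchemeOver ℂ), IsSmoothProjective m Y → m < 2 * p → ∀ g : Y ⟶ X,
      complexBetti.map g (2 * p) c = 0 :=
  isInvisible_of_isTranscendental_of_ratSpanned hX A (invisibleClasses_ratSpanned hX) ht

end Summit.HodgeConjecture.HodgeConjecture.Cruxes.TranscendentalOrSupported.CurveSweep

end
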